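/-
Copyright (c) 2026 the pub-hodgecm-mathlib formalisation cell (harness21).  Prover seat hodgecm-mathlib-K2E3-p06 (g7), Track B «K2-LIT»,
#184♮ = hLiu418 = `stmt-HodgeConjecture-24832`; socket #41, KIND W, (iii-fin) row (KW-fin-stab) — LEAD F0P6-plan (g15) BATCH #215 (1), KW desk F0P2-p08 (g4):
FILE 1 of the QUANTITATIVE radius-stability letter `hstab` of ★ p863720 `K2LiuKindWFiniteSizeLetterOfPlace.hsizeLoc_of_place` — the LEVEL of the Siegel–Levi moves.
THEOREMS ONLY (no `def`, no `instance`, no notation, no named-fact hypothesis, no `sorry`); lane `--supports stmt-HodgeConjecture-24832` (count-neutral helper).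
-/
import Summits.HodgeConjecture.HodgeConjecture.Theorems.K2LiuUnipotentDeepLevel        -- ★ (lat-a): `apply_mem_congruenceGL_of_valBound`, `valBound_cayRinv`, `isIntegralAt_of_valBound_sub_one`, `valBound_map_mul`
import Summits.HodgeConjecture.HodgeConjecture.Theorems.K2LiuSiegelLeviWeylAlgebra      -- ★ `isUnit_det_blkA_blkD`
import Summits.HodgeConjecture.HodgeConjecture.Theorems.K2LiuLocalRingValuationBalls    -- ★ F3c-1: `mball_smul`, `mball_antitone`, `valued_toPlace_uniformizer_le`, `valued_toPlace_uniformizer_ne_zero`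
import Literature.NumberTheory.Automorphic.ValuedFieldValuativeRelBridge                -- ★ `v_le_iff_valuation_le`, `v_le_one_iff_valuation_le_one`
import Literature.NumberTheory.Automorphic.AdicCompletionLocalField                     -- ★ instances `ValuativeRel ∕ Valued.v.Compatible` on `w.adicCompletion E`
import HarnessLib

/-!
# Crux `HLiu418`, socket #41, KIND W, (KW-fin-stab) FILE 1 — `K2LiuLocalLeviSupplyLevel`: THE SIEGEL–LEVI MOVES `m(1 + ẑu)` OF KAREL'S LEMMA ARE DEEP —
# `m(1+ẑu)_w ∈ K_w(ϖ_w^M) = congruenceGL (n+n) (valuation ϖ_w ^ M)` AS SOON AS `ord_v z ≥ M + 2b_T + c₂` (the level of ★ F3a's Levi supply, quantitatively)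

Cell `hodgecm-mathlib`, crux item hLiu418 = `stmt-HodgeConjecture-24832` (helper lane `--supports … --as helper`, count-neutral), route of record `HCCMUnconditional`;
squad K2 ∕ K2Liu, road `K2_Liu`, socket #41 `sig_K2LiuSiegelEisensteinContinuation`, KIND W, (iii-fin) row; LEAD F0P6-plan (g15) BATCH #215 (1) dealt the QUANTITATIVE
radius-stability letter `hstab` of ★ p863720 (`∃ R ≤ Σ_{w∣v}(ρ w + a₁·lev h w + a₂·dS w + a₃·dA w)`, the Φ5-ball integrals constant beyond `R`).  THE FINDING of the census
(K2 bus 2026-09-05, K2E3-p06 (g7)): ★ Φ5 `K2LiuBadPlaceWhittakerEntire.whittaker_setIntegral_ball_eq` is quantitative in the Fourier index (`K₁ + 4b + 2b′`) but NOT in the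
LEVEL — its `K₁` contains ★ F3a `K2LiuLocalLeviSupply.exists_ball_levi_supply`'s radius `j₀`, an `∃` obtained by continuity at `0` for an OPEN smoothness group `U`; the level
of the translate `g ↦ FvT j S h v s (g·h_v)` moves with `h` (★ p863964), so `a₁·lev h w` needs the Levi supply radius AFFINE IN THE PRINCIPAL LEVEL EXPONENT.  THIS FILE
(generic GR91 local frame `(F, E, c, v, n, T₀, JD)` of ★ `LocalDoubledUnitaryUnramifiedCell`, the currency of ★ (lat-a) `K2LiuUnipotentDeepLevel`) supplies exactly that:
* §1 `matA_sub_one_eq_of_levi` — for a Siegel–Levi element `q` (`blkC (matA q) = 0 = blkB (matA q)`): `matA q − 1 = R · diag(A − 1, D − 1) · R⁻¹` (`A = blkA`, `D = blkD`,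
  ★ `adapt_eq`, `R R⁻¹ = 1`); `valBound_fromBlocks_diag`; **`valBound_matA_sub_one_of_levi`** — the `w`-entries of `matA q − 1` are `≤ γ` when those of `A − 1`, `D − 1` are
  `≤ |2|_w·γ` (`R` integral, `|R⁻¹| ≤ |2|_w⁻¹`, ★ `valBound_cayRinv`; every place, dyadic included).
* §2 `adapt_matA_inv_of_levi`, `blk_matA_inv_of_levi` — `q⁻¹` is Siegel–Levi with blocks `A⁻¹`, `D⁻¹` (★ `adapt_mul`, ★ `isUnit_det_blkA_blkD`; `matA q⁻¹ = (matA q)⁻¹` is ★ `K2LiuSiegelLeviWeylAlgebra.matA_inv`).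
* §3 HEAD **`levi_apply_mem_congruenceGL`** — `γ ≤ 1` and the four letters `A − 1, D − 1, A⁻¹ − 1, D⁻¹ − 1 ≡ 0 (|2|_w·γ)` ⟹ `(q : LocalGLPi) w ∈ congruenceGL (n+n) γ`
  (★ `apply_mem_congruenceGL_of_valBound`, integrality from `≡ 1 (γ)`); **`levi_apply_mem_congruenceGL_of_blocks`** — the same from `A = 1 + X`, `D⁻¹ = 1 + Y` with
  `X, Y ≡ 0 (|2|_w·γ)` and `A⁻¹`, `D` integral at `w` (`A⁻¹ − 1 = −A⁻¹X`, `D − 1 = −DY`) — ★ F3a's supply shape `A = 1 + ẑ•u`, `D⁻¹ = 1 + ẑ•u′`.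
* §4 **`levi_apply_mem_congruenceGL_pow`** — THE EXPONENT READING in ★ F4b-1's ball currency: `z ∈ 𝔭_v^j`, `u ∈ ball(0)`, `u′ ∈ ball(−b_u)` (`0 ≤ b_u`), `(1+ẑu)⁻¹`, `(1+ẑu′)⁻¹`
  integral, `ϖ_v^{c₂} ∣ 2` at `w`, a uniformiser `ϖ_w` of `E_w`, and **`M + b_u + c₂ ≤ j`** ⟹ `(q : LocalGLPi) w ∈ congruenceGL (n+n) (valuation ϖ_w ^ M)`
  (`|ι_w π| ≤ |ϖ_w|`, so `|ι_w π|^M ≤ |ϖ_w|^M`; ★ `mball_smul`, ★ `v_le_iff_valuation_le`).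
[Casselman1980, §3 (the Levi moves of Karel's lemma live in a congruence subgroup of controlled level)]; [PlatonovRapinchuk1994, §5.1 (principal congruence subgroups)];
[HarrisKudlaSweet1996, §1 (1.11)–(1.12) (the Siegel Levi `m(a) = R·diag(a, ᵗā⁻¹)·R⁻¹`)]; [KudlaRallis1994, §2].
HONEST LABEL.  Count-neutral helper, closes no socket: `HC_CM` is proved only modulo the 7 printed citations (2 remaining named inputs: hLiu418 = `stmt-HodgeConjecture-24832`,
h413 = `stmt-HodgeConjecture-24833`) until rung 0 closes.  NOT HERE: FILE 2 (★ F4b-1 re-assembled with this supply: far shells dead for `k ≥ K₀ + M + 4b + 2b′`) and FILE 3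
(the dealt (iii-fin) letter `hstab_of_level_conductor`).

## References
* [Casselman1980] W. Casselman, *The unramified principal series of p-adic groups I*, Compositio Math. 40 (1980): §3.
* [PlatonovRapinchuk1994] V. Platonov, A. Rapinchuk, *Algebraic Groups and Number Theory* (1994): §5.1.
* [HarrisKudlaSweet1996] M. Harris, S. Kudla, W. J. Sweet, *Theta dichotomy for unitary groups*, J. AMS 9 (1996): §1 (1.11)–(1.12).
* [KudlaRallis1994] S. Kudla, S. Rallis, *A regularized Siegel–Weil formula: the first term identity*, Ann. of Math. 140 (1994): §2.
-/

set_option autoImplicit false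
set_option linter.dupNamespace false -- the mandated namespace repeats `HodgeConjecture.HodgeConjecture`

noncomputable section

open NumberField IsDedekindDomain Matrix
open scoped ValuativeRel MatrixGroups
open Literature.NumberTheory.Automorphic Literature.NumberTheory.Automorphic.UnitaryGroup
open Literature.NumberTheory.GelbartRogawski1991 Literature.NumberTheory.GelbartRogawski1991.AdaptedBlocks
open Literature.NumberTheory.GelbartRogawski1991.UnitaryDualPair Literature.NumberTheory.GelbartRogawski1991.UnitaryDualPair.LocalSplitting
open Summit.HodgeConjecture.HodgeConjecture.Cruxes.HLiu418.K2LiuUnipotentDeepLevel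
  (valBound_map_mul apply_mem_congruenceGL_of_valBound valBound_cayRinv isIntegralAt_of_valBound_sub_one valBound_map_neg)
open Summit.HodgeConjecture.HodgeConjecture.Cruxes.HLiu418.K2LiuSiegelLeviWeylAlgebra (isUnit_det_blkA_blkD)
open Summit.HodgeConjecture.HodgeConjecture.Cruxes.HLiu418.K2LiuLocalRingValuationBalls

namespace Summit.HodgeConjecture.HodgeConjecture.Cruxes.HLiu418.K2LiuLocalLeviSupplyLevel

variable (F : Type) [Field F] [NumberField F] (E : Type) [Field E] [NumberField E] [Algebra F E] (c : E ≃ₐ[F] E)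
  (v : HeightOneSpectrum (𝓞 F)) (n : ℕ) {JD : Matrix (Fin (n + n)) (Fin (n + n)) E}

/-! ## §1 The adapted frame of a Siegel–Levi element: `matA q − 1 = R · diag(A − 1, D − 1) · R⁻¹` -/

section Levi

variable {w : PlacesOver E v}

/-- `M = R · adapt M · R⁻¹` (`adapt M = R⁻¹ M R`, `R R⁻¹ = 1`). [cite: HarrisKudlaSweet1996, §1 (1.11)] -/
theorem eq_cayR_mul_adapt_mul_cayRinv (M : Matrix (Fin n ⊕ Fin n) (Fin n ⊕ Fin n) (LocalRing E v)) :
    M = cayR (LocalRing E v) (Fin n) * adapt M * cayRinv (LocalRing E v) (Fin n) := by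
  rw [adapt, ← Matrix.mul_assoc, ← Matrix.mul_assoc, cayR_mul_cayRinv, Matrix.one_mul, Matrix.mul_assoc, cayR_mul_cayRinv, Matrix.mul_one]

/-- **`matA q − 1 = R · diag(A − 1, D − 1) · R⁻¹`** for a Siegel–Levi element `q` (`blkC (matA q) = 0`, `blkB (matA q) = 0`; `A = blkA`, `D = blkD`; ★ `adapt_eq`).
[cite: HarrisKudlaSweet1996, §1 (1.11)–(1.12)] -/
theorem matA_sub_one_eq_of_levi (q : UnitaryGroup.localPi E c (n + n) JD v) (hC : blkC (matA F E c v n q) = 0) (hB : blkB (matA F E c v n q) = 0) :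
    matA F E c v n q - 1 =
      cayR (LocalRing E v) (Fin n) * Matrix.fromBlocks (blkA (matA F E c v n q) - 1) 0 0 (blkD (matA F E c v n q) - 1) * cayRinv (LocalRing E v) (Fin n) := by
  have hfb : (Matrix.fromBlocks (blkA (matA F E c v n q) - 1) 0 0 (blkD (matA F E c v n q) - 1) :
      Matrix (Fin n ⊕ Fin n) (Fin n ⊕ Fin n) (LocalRing E v)) =
      Matrix.fromBlocks (blkA (matA F E c v n q)) 0 0 (blkD (matA F E c v n q)) - 1 := by
    rw [eq_sub_iff_add_eq, ← Matrix.fromBlocks_one, Matrix.fromBlocks_add]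
    simp
  rw [hfb, Matrix.mul_sub, Matrix.sub_mul, Matrix.mul_one, cayR_mul_cayRinv]
  congr 1
  conv_lhs => rw [eq_cayR_mul_adapt_mul_cayRinv F E v n (matA F E c v n q), adapt_eq, hB, hC]

omit [NumberField F] in
/-- the `w`-entries of a block-diagonal matrix `diag(X, Y)` are bounded by those of `X`, `Y`. [folklore] -/
theorem valBound_fromBlocks_diag {γ : ValuativeRel.ValueGroupWithZero (w.1.adicCompletion E)} {X Y : Matrix (Fin n) (Fin n) (LocalRing E v)}
    (hX : ValBound γ (X.map (Pi.evalRingHom (fun w' : PlacesOver E v => w'.1.adicCompletion E) w)))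
    (hY : ValBound γ (Y.map (Pi.evalRingHom (fun w' : PlacesOver E v => w'.1.adicCompletion E) w))) :
    ValBound γ ((Matrix.fromBlocks X 0 0 Y : Matrix (Fin n ⊕ Fin n) (Fin n ⊕ Fin n) (LocalRing E v)).map
      (Pi.evalRingHom (fun w' : PlacesOver E v => w'.1.adicCompletion E) w)) := by
  rintro (i | i) (j | j)
  · exact hX i j
  · simp
  · simp
  · exact hY i j

/-- **THE `w`-ENTRIES OF `matA q − 1` ARE `≤ γ` WHEN THOSE OF `A − 1`, `D − 1` ARE `≤ |2|_w·γ`** (Siegel–Levi `q`; `R` integral ★ `isIntegralAt_cayR`, `|R⁻¹| ≤ |2|_w⁻¹`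
★ `valBound_cayRinv`; every place, dyadic included). [cite: HarrisKudlaSweet1996, §1 (1.11)] [cite: PlatonovRapinchuk1994, §5.1] -/
theorem valBound_matA_sub_one_of_levi (q : UnitaryGroup.localPi E c (n + n) JD v) (hC : blkC (matA F E c v n q) = 0) (hB : blkB (matA F E c v n q) = 0)
    {γ : ValuativeRel.ValueGroupWithZero (w.1.adicCompletion E)}
    (hA : ValBound (ValuativeRel.valuation (w.1.adicCompletion E) (2 : w.1.adicCompletion E) * γ)
      ((blkA (matA F E c v n q) - 1).map (Pi.evalRingHom (fun w' : PlacesOver E v => w'.1.adicCompletion E) w)))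
    (hD : ValBound (ValuativeRel.valuation (w.1.adicCompletion E) (2 : w.1.adicCompletion E) * γ)
      ((blkD (matA F E c v n q) - 1).map (Pi.evalRingHom (fun w' : PlacesOver E v => w'.1.adicCompletion E) w))) :
    ValBound γ ((matA F E c v n q - 1).map (Pi.evalRingHom (fun w' : PlacesOver E v => w'.1.adicCompletion E) w)) := by
  rw [matA_sub_one_eq_of_levi F E c v n q hC hB]
  have hR : ValBound 1 ((cayR (LocalRing E v) (Fin n)).map (Pi.evalRingHom (fun w' : PlacesOver E v => w'.1.adicCompletion E) w)) :=
    isIntegralAt_cayR F E v n w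
  have h := valBound_map_mul (valBound_map_mul hR (valBound_fromBlocks_diag F E v n hA hD)) (valBound_cayRinv F E v n (w := w))
  have h2 : ValuativeRel.valuation (w.1.adicCompletion E) (2 : w.1.adicCompletion E) ≠ 0 :=
    (Valuation.ne_zero_iff _).2 two_ne_zero
  rwa [one_mul, mul_comm (ValuativeRel.valuation (w.1.adicCompletion E) 2) γ, mul_inv_cancel_right₀ h2] at h

/-! ## §2 The inverse of a Siegel–Levi element is Siegel–Levi with blocks `A⁻¹`, `D⁻¹` -/

/-- **`adapt (matA q⁻¹) = diag(A⁻¹, D⁻¹)`** for a Siegel–Levi `q` (`adapt` multiplicative ★ `adapt_mul`, `A`, `D` invertible ★ `isUnit_det_blkA_blkD`).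
[cite: HarrisKudlaSweet1996, §1 (1.11)–(1.12)] -/
theorem adapt_matA_inv_of_levi (q : UnitaryGroup.localPi E c (n + n) JD v) (hC : blkC (matA F E c v n q) = 0) (hB : blkB (matA F E c v n q) = 0) :
    adapt (matA F E c v n q⁻¹) = Matrix.fromBlocks (blkA (matA F E c v n q))⁻¹ 0 0 (blkD (matA F E c v n q))⁻¹ := by
  obtain ⟨hAu, hDu⟩ := isUnit_det_blkA_blkD F E c v n hC
  have hadapt : adapt (matA F E c v n q) = Matrix.fromBlocks (blkA (matA F E c v n q)) 0 0 (blkD (matA F E c v n q)) := by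
    rw [adapt_eq, hB, hC]
  have h1 : adapt (matA F E c v n q⁻¹) * Matrix.fromBlocks (blkA (matA F E c v n q)) 0 0 (blkD (matA F E c v n q)) = 1 := by
    rw [← hadapt, ← adapt_mul, matA_mul, inv_mul_cancel, matA_one, adapt_one]
  have h2 : Matrix.fromBlocks (blkA (matA F E c v n q))⁻¹ 0 0 (blkD (matA F E c v n q))⁻¹ *
      Matrix.fromBlocks (blkA (matA F E c v n q)) 0 0 (blkD (matA F E c v n q)) = 1 := by
    rw [Matrix.fromBlocks_multiply, Matrix.nonsing_inv_mul _ hAu, Matrix.nonsing_inv_mul _ hDu, ← Matrix.fromBlocks_one]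
    simp
  exact (Matrix.inv_eq_left_inv h1).symm.trans (Matrix.inv_eq_left_inv h2)

/-- **the blocks of `q⁻¹`**: `blkC = 0`, `blkB = 0`, `blkA (matA q⁻¹) = A⁻¹`, `blkD (matA q⁻¹) = D⁻¹` (★ `adapt_eq` + `fromBlocks_inj`). [cite: HarrisKudlaSweet1996, §1 (1.11)] -/
theorem blk_matA_inv_of_levi (q : UnitaryGroup.localPi E c (n + n) JD v) (hC : blkC (matA F E c v n q) = 0) (hB : blkB (matA F E c v n q) = 0) :
    blkC (matA F E c v n q⁻¹) = 0 ∧ blkB (matA F E c v n q⁻¹) = 0 ∧ blkA (matA F E c v n q⁻¹) = (blkA (matA F E c v n q))⁻¹ ∧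
      blkD (matA F E c v n q⁻¹) = (blkD (matA F E c v n q))⁻¹ := by
  have h := adapt_matA_inv_of_levi F E c v n q hC hB
  rw [adapt_eq] at h
  obtain ⟨hA', hB', hC', hD'⟩ := Matrix.fromBlocks_inj.1 h
  exact ⟨hC', hB', hA', hD'⟩

/-! ## §3 HEAD: a Siegel–Levi element congruent to `1` in its blocks lies in the principal congruence subgroup -/

/-- **SIEGEL–LEVI ELEMENTS CONGRUENT TO `1` ARE DEEP.**  `q ∈ P_Δ(F_v)` Siegel–Levi (`blkC (matA q) = 0 = blkB (matA q)`), `γ ≤ 1`, and at the place `w ∣ v` the four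
letters `A − 1, D − 1, A⁻¹ − 1, D⁻¹ − 1 ≡ 0 (|2|_w·γ)` (`A = blkA (matA q)`, `D = blkD (matA q)`); THEN `(q : LocalGLPi) w ∈ congruenceGL (n+n) γ` — §1 for `q` and, via §2,
for `q⁻¹`; integrality from `≡ 1 (γ)` (★ `isIntegralAt_of_valBound_sub_one`), then ★ `apply_mem_congruenceGL_of_valBound`.
[cite: PlatonovRapinchuk1994, §5.1] [cite: Casselman1980, §3] [cite: HarrisKudlaSweet1996, §1 (1.11)–(1.12)] -/
theorem levi_apply_mem_congruenceGL (q : UnitaryGroup.localPi E c (n + n) JD v) (hC : blkC (matA F E c v n q) = 0) (hB : blkB (matA F E c v n q) = 0)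
    {γ : ValuativeRel.ValueGroupWithZero (w.1.adicCompletion E)} (hγ : γ ≤ 1)
    (hA : ValBound (ValuativeRel.valuation (w.1.adicCompletion E) (2 : w.1.adicCompletion E) * γ)
      ((blkA (matA F E c v n q) - 1).map (Pi.evalRingHom (fun w' : PlacesOver E v => w'.1.adicCompletion E) w)))
    (hD : ValBound (ValuativeRel.valuation (w.1.adicCompletion E) (2 : w.1.adicCompletion E) * γ)
      ((blkD (matA F E c v n q) - 1).map (Pi.evalRingHom (fun w' : PlacesOver E v => w'.1.adicCompletion E) w)))
    (hAi : ValBound (ValuativeRel.valuation (w.1.adicCompletion E) (2 : w.1.adicCompletion E) * γ)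
      (((blkA (matA F E c v n q))⁻¹ - 1).map (Pi.evalRingHom (fun w' : PlacesOver E v => w'.1.adicCompletion E) w)))
    (hDi : ValBound (ValuativeRel.valuation (w.1.adicCompletion E) (2 : w.1.adicCompletion E) * γ)
      (((blkD (matA F E c v n q))⁻¹ - 1).map (Pi.evalRingHom (fun w' : PlacesOver E v => w'.1.adicCompletion E) w))) :
    (q : UnitaryGroup.LocalGLPi E (n + n) v) w ∈ congruenceGL (n + n) γ := by
  obtain ⟨hC', hB', hA', hD'⟩ := blk_matA_inv_of_levi F E c v n q hC hB
  have h1 := valBound_matA_sub_one_of_levi F E c v n q hC hB hA hD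
  have h1' : ValBound γ ((matA F E c v n q⁻¹ - 1).map (Pi.evalRingHom (fun w' : PlacesOver E v => w'.1.adicCompletion E) w)) := by
    refine valBound_matA_sub_one_of_levi F E c v n q⁻¹ hC' hB' ?_ ?_
    · rw [hA']; exact hAi
    · rw [hD']; exact hDi
  exact apply_mem_congruenceGL_of_valBound F E c v n q γ (isIntegralAt_of_valBound_sub_one F E v hγ h1)
    (isIntegralAt_of_valBound_sub_one F E v hγ h1') h1 h1'

/-- **THE SUPPLY SHAPE** (★ F3a `exists_ball_levi_supply`: `A = 1 + X`, `D⁻¹ = 1 + Y` with `X = ẑ•u`, `Y = ẑ•u′`): if `X, Y ≡ 0 (|2|_w·γ)`, `γ ≤ 1`, and `A⁻¹ = (1 + X)⁻¹`,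
`D = (1 + Y)⁻¹` are `w`-integral, then `(q : LocalGLPi) w ∈ congruenceGL (n+n) γ` (`A⁻¹ − 1 = −A⁻¹·X`, `D − 1 = −D·Y`).
[cite: PlatonovRapinchuk1994, §5.1] [cite: Casselman1980, §3] [cite: HarrisKudlaSweet1996, §1 (1.12)] -/
theorem levi_apply_mem_congruenceGL_of_blocks (q : UnitaryGroup.localPi E c (n + n) JD v) (hC : blkC (matA F E c v n q) = 0) (hB : blkB (matA F E c v n q) = 0)
    {X Y : Matrix (Fin n) (Fin n) (LocalRing E v)} (hAX : blkA (matA F E c v n q) = 1 + X) (hDY : (blkD (matA F E c v n q))⁻¹ = 1 + Y)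
    {γ : ValuativeRel.ValueGroupWithZero (w.1.adicCompletion E)} (hγ : γ ≤ 1)
    (hX : ValBound (ValuativeRel.valuation (w.1.adicCompletion E) (2 : w.1.adicCompletion E) * γ) (X.map (Pi.evalRingHom (fun w' : PlacesOver E v => w'.1.adicCompletion E) w)))
    (hY : ValBound (ValuativeRel.valuation (w.1.adicCompletion E) (2 : w.1.adicCompletion E) * γ) (Y.map (Pi.evalRingHom (fun w' : PlacesOver E v => w'.1.adicCompletion E) w)))
    (hAi : IsIntegralAt F E v w (blkA (matA F E c v n q))⁻¹) (hDi : IsIntegralAt F E v w (blkD (matA F E c v n q))) :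
    (q : UnitaryGroup.LocalGLPi E (n + n) v) w ∈ congruenceGL (n + n) γ := by
  obtain ⟨hAu, hDu⟩ := isUnit_det_blkA_blkD F E c v n hC
  set A := blkA (matA F E c v n q) with hAdef
  set D := blkD (matA F E c v n q) with hDdef
  -- the four letters
  have hA1 : A - 1 = X := by rw [hAX, add_sub_cancel_left]
  have hDi1 : D⁻¹ - 1 = Y := by rw [hDY, add_sub_cancel_left]
  have hAi1 : A⁻¹ - 1 = -(A⁻¹ * X) := by
    have h : A⁻¹ * A = 1 := Matrix.nonsing_inv_mul _ hAu
    calc A⁻¹ - 1 = A⁻¹ - A⁻¹ * A := by rw [h]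
      _ = -(A⁻¹ * (A - 1)) := by rw [Matrix.mul_sub, Matrix.mul_one, neg_sub]
      _ = -(A⁻¹ * X) := by rw [hA1]
  have hD1 : D - 1 = -(D * Y) := by
    have h : D * D⁻¹ = 1 := Matrix.mul_nonsing_inv _ hDu
    calc D - 1 = D - D * D⁻¹ := by rw [h]
      _ = -(D * (D⁻¹ - 1)) := by rw [Matrix.mul_sub, Matrix.mul_one, neg_sub]
      _ = -(D * Y) := by rw [hDi1]
  refine levi_apply_mem_congruenceGL F E c v n q hC hB hγ ?_ ?_ ?_ ?_
  · rw [← hAdef, hA1]; exact hX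
  · rw [← hDdef, hD1]
    have h := valBound_map_mul hDi hY
    rw [one_mul] at h
    exact valBound_map_neg F E v n h
  · rw [← hAdef, hAi1]
    have h := valBound_map_mul hAi hX
    rw [one_mul] at h
    exact valBound_map_neg F E v n h
  · rw [← hDdef, hDi1]; exact hY

end Levi

/-! ## §4 The exponent reading in ★ F4b-1's ball currency -/

section Exponent

variable {π : v.adicCompletion F} (hπ : Valued.v π = WithZero.exp (-1 : ℤ))

include hπ in
/-- **ball ⟹ `|2|_w·ϖ_w^M`-bound**: if `X ∈ ball(M + c₂)` (`|X_{ab,w}| ≤ |ι_w π|^{M + c₂}` for all `w ∣ v`) and `|ι_w π|^{c₂} ≤ |2|_w`, then for a uniformiser `ϖ_w` of `E_w`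
(`|ϖ_w| = exp(−1) ≥ |ι_w π|`, ★ `valued_toPlace_uniformizer_le`) every `w`-entry of `X` has `valuation ≤ valuation 2 · valuation ϖ_w ^ M` (★ `v_le_iff_valuation_le`).
[cite: CasselsFrohlichANT1967, Ch. II §10] [cite: PlatonovRapinchuk1994, §5.1] -/
theorem valBound_two_mul_pow_of_mball (w : PlacesOver E v) {c₂ : ℤ} (h2 : Valued.v (toPlace v w π) ^ c₂ ≤ Valued.v ((2 : LocalRing E v) w))
    {ϖ : w.1.adicCompletion E} (hϖ : Valued.v ϖ = WithZero.exp (-1 : ℤ)) (M : ℕ) {X : Matrix (Fin n) (Fin n) (LocalRing E v)}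
    (hX : ∀ a b (w' : PlacesOver E v), Valued.v (X a b w') ≤ Valued.v (toPlace v w' π) ^ ((M : ℤ) + c₂)) :
    ValBound (ValuativeRel.valuation (w.1.adicCompletion E) (2 : w.1.adicCompletion E) * ValuativeRel.valuation (w.1.adicCompletion E) ϖ ^ M)
      (X.map (Pi.evalRingHom (fun w' : PlacesOver E v => w'.1.adicCompletion E) w)) := by
  intro a b
  rw [Matrix.map_apply, Pi.evalRingHom_apply, ← map_pow, ← map_mul, ← v_le_iff_valuation_le, map_mul, map_pow]
  have hne : Valued.v (toPlace v w π) ≠ 0 := valued_toPlace_uniformizer_ne_zero F E v hπ w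
  have hπϖ : Valued.v (toPlace v w π) ^ M ≤ Valued.v ϖ ^ M := by
    have h1 : Valued.v (toPlace v w π) ≤ Valued.v ϖ := by rw [hϖ]; exact valued_toPlace_uniformizer_le F E v hπ w
    exact pow_le_pow_left' h1 M
  calc Valued.v (X a b w) ≤ Valued.v (toPlace v w π) ^ ((M : ℤ) + c₂) := hX a b w
    _ = Valued.v (toPlace v w π) ^ c₂ * Valued.v (toPlace v w π) ^ M := by rw [zpow_add₀ hne, zpow_natCast, mul_comm]
    _ ≤ Valued.v (2 : w.1.adicCompletion E) * Valued.v ϖ ^ M := mul_le_mul' h2 hπϖ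

include hπ in
/-- **THE LEVEL OF THE SIEGEL–LEVI MOVES `m(1 + ẑu)`** (★ F3a's supply, quantitatively).  For a Siegel–Levi `q` with `blkA (matA q) = 1 + ẑ•u`, `(blkD (matA q))⁻¹ = 1 + ẑ•u′`
(`ẑ = toLocalRing z`), `z ∈ 𝔭_v^j`, `u ∈ ball(0)`, `u′ ∈ ball(−b_u)` (`0 ≤ b_u`; for ★ F4b-1's directions `u′ = T⁻¹σ(u)ᵀT`, `b_u = 2b_T`), the inverses `(1+ẑu)⁻¹`, `(1+ẑu′)⁻¹` in
`ball(0)` (★ F4b-1's `j₁` letter), `|ι_w π|^{c₂} ≤ |2|_w`, a uniformiser `ϖ_w` of `E_w` at the place `w ∣ v`, and an exponent `M : ℕ` with **`M + b_u + c₂ ≤ j`**: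
`(q : LocalGLPi) w ∈ K_w(ϖ_w^M) = congruenceGL (n+n) (valuation ϖ_w ^ M)`.  (`ẑ•u ∈ ball(j) ⊆ ball(M + c₂)`, `ẑ•u′ ∈ ball(j − b_u) ⊆ ball(M + c₂)`, ★ `mball_smul` ∕
`mball_antitone`; then `valBound_two_mul_pow_of_mball` and §3.) [cite: Casselman1980, §3] [cite: PlatonovRapinchuk1994, §5.1] [cite: HarrisKudlaSweet1996, §1 (1.12)] -/
theorem levi_apply_mem_congruenceGL_pow (q : UnitaryGroup.localPi E c (n + n) JD v) (hC : blkC (matA F E c v n q) = 0) (hB : blkB (matA F E c v n q) = 0)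
    {z : v.adicCompletion F} {j : ℤ} (hz : z ∈ primePowBall (v.adicCompletion F) j) {u u' : Matrix (Fin n) (Fin n) (LocalRing E v)} {bu : ℤ} (hbu : 0 ≤ bu)
    (hu : ∀ a b (w' : PlacesOver E v), Valued.v (u a b w') ≤ Valued.v (toPlace v w' π) ^ (0 : ℤ))
    (hu' : ∀ a b (w' : PlacesOver E v), Valued.v (u' a b w') ≤ Valued.v (toPlace v w' π) ^ (-bu))
    (hAX : blkA (matA F E c v n q) = 1 + toLocalRing E v z • u) (hDY : (blkD (matA F E c v n q))⁻¹ = 1 + toLocalRing E v z • u')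
    (hAi : ∀ a b (w' : PlacesOver E v), Valued.v ((1 + toLocalRing E v z • u)⁻¹ a b w') ≤ Valued.v (toPlace v w' π) ^ (0 : ℤ))
    (hDi : ∀ a b (w' : PlacesOver E v), Valued.v ((1 + toLocalRing E v z • u')⁻¹ a b w') ≤ Valued.v (toPlace v w' π) ^ (0 : ℤ))
    (w : PlacesOver E v) {c₂ : ℤ} (h2 : Valued.v (toPlace v w π) ^ c₂ ≤ Valued.v ((2 : LocalRing E v) w))
    {ϖ : w.1.adicCompletion E} (hϖ : Valued.v ϖ = WithZero.exp (-1 : ℤ)) (M : ℕ) (hM : (M : ℤ) + bu + c₂ ≤ j) :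
    (q : UnitaryGroup.LocalGLPi E (n + n) v) w ∈ congruenceGL (n + n) (ValuativeRel.valuation (w.1.adicCompletion E) ϖ ^ M) := by
  obtain ⟨hAu, hDu⟩ := isUnit_det_blkA_blkD F E c v n hC
  -- the two blocks in the ball `M + c₂`
  have hX : ∀ a b (w' : PlacesOver E v), Valued.v ((toLocalRing E v z • u) a b w') ≤ Valued.v (toPlace v w' π) ^ ((M : ℤ) + c₂) :=
    mball_antitone F E v hπ (by omega) (mball_smul F E v hπ hz hu)
  have hY : ∀ a b (w' : PlacesOver E v), Valued.v ((toLocalRing E v z • u') a b w') ≤ Valued.v (toPlace v w' π) ^ ((M : ℤ) + c₂) :=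
    mball_antitone F E v hπ (by omega) (mball_smul F E v hπ hz hu')
  -- integrality of `A⁻¹ = (1 + ẑu)⁻¹` and of `D = ((1 + ẑu′)⁻¹)`
  have hAi' : IsIntegralAt F E v w (blkA (matA F E c v n q))⁻¹ := fun a b => by
    rw [Matrix.map_apply, Pi.evalRingHom_apply, ← v_le_one_iff_valuation_le_one, hAX]
    have h := hAi a b w
    rwa [zpow_zero] at h
  have hDi' : IsIntegralAt F E v w (blkD (matA F E c v n q)) := fun a b => by
    rw [Matrix.map_apply, Pi.evalRingHom_apply, ← v_le_one_iff_valuation_le_one]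
    have hD : blkD (matA F E c v n q) = (1 + toLocalRing E v z • u')⁻¹ := by
      rw [← hDY, Matrix.nonsing_inv_nonsing_inv _ hDu]
    rw [hD]
    have h := hDi a b w
    rwa [zpow_zero] at h
  have hϖ1 : ValuativeRel.valuation (w.1.adicCompletion E) ϖ ≤ 1 := by
    have h1 : Valued.v ϖ ≤ Valued.v (1 : w.1.adicCompletion E) := by
      rw [hϖ, map_one, ← WithZero.exp_zero]
      exact WithZero.exp_le_exp.2 (by norm_num)
    simpa only [map_one] using (v_le_iff_valuation_le _ _).1 h1
  exact levi_apply_mem_congruenceGL_of_blocks F E c v n q hC hB hAX hDY (pow_le_one' hϖ1 M)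
    (valBound_two_mul_pow_of_mball F E v n hπ w h2 hϖ M hX) (valBound_two_mul_pow_of_mball F E v n hπ w h2 hϖ M hY) hAi' hDi'

end Exponent

end Summit.HodgeConjecture.HodgeConjecture.Cruxes.HLiu418.K2LiuLocalLeviSupplyLevel

end
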